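import Mathlib
import Summits.MatrixMultiplication.Statement
import Summits.MatrixMultiplication.MatrixMultiplication.Theorems.GraphEquationsDepthLadderSharp

/-!
# Graph equations — POINTWISE PURIFICATION: `CubicEquationsForceMultiplication` reduced to one
# classical fixed-point lemma (M64)

Continuation of M57–M63 (horizontal unmasking; the depth dial `DepthBound n d ↔ HorizontalUnmask d n`,
whose rung `d = 1` implies `CubicEquationsForceMultiplication` = `[ω₃ = ω]`, M62).

**THEOREM (pointwise purification, modulo ISO).**  Let `S` be a CORRECT affine system and `(A,B)`
ANY base point.  Then some base line `(A,B) + ℂ(U,V)` carries no nonzero persistent kernel vector,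
i.e. two horizontal rounds along `(U,V)` purify `S` at `(A,B)`
(`AffSystem.Correct.exists_line_reduced_of_iso`).  Consequently `DepthBound n 1` for every `n`,
`HorizontalUnmask 1 n`, and **`CubicEquationsForceMultiplication`**
(`cubicEquationsForceMultiplication_of_iso`) — all conditional on ONE hypothesis of pure linear
algebra, the

**ISOTROPIC KERNEL LEMMA `IsotropicKernelLemma d`:** *if `b₁, …, b_m` are bilinear forms on a
complex vector space `V ≠ 0` of dimension `≤ d` such that every `x ≠ 0` is left-`b`-orthogonal to
SOME `y ≠ 0` (`bᵢ(x,y) = 0 ∀ i`), then some `x ≠ 0` is `b`-isotropic (`bᵢ(x,x) = 0 ∀ i`).*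
This is the fixed-point principle for algebraic correspondences on projective space: the
correspondence `Z = {([x],[y]) : bᵢ(x,y) = 0} ⊂ ℙV × ℙV` surjects onto the first factor, a
component `Z₀` dominating `ℙV`, cut to relative dimension `0`, has class `Σ aⱼ h₁ʲ h₂^{k-j}` with
`a₀ = deg(pr₁) ≥ 1`, and `[Z₀]·[Δ] = Σ aⱼ ≥ 1`, so `Z ∩ Δ ≠ ∅` (Chow ring of `ℙᵏ × ℙᵏ`).  It is NOT
yet in the tree (no intersection theory in Mathlib); we prove the case `d ≤ 1` here
(`isotropicKernelLemma_one`), which recovers M63's `corank ≤ 1 somewhere ⇒ depth ≤ 1`; the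
compression-space case follows from `Literature.…HomogeneousCommonZero`; the general case is the ONE
remaining lemma between the tree and `[ω₃ = ω]`.

**Proof of the theorem** (all formal below).  Suppose every line through `y₀ = (A,B)` carries a
nonzero persistent vector (`H`).  Let `K = K(y₀)` and `E = P_{(0,𝟙)}` = the persistent vectors along
the direction `(0, 𝟙)` (a subspace; `E ≠ 0` by `H`).
* (B) For `δ ∈ Vec n` and `μ ≠ 0` apply `H` to the direction `(-μ⁻¹·δ, 𝟙)`: since the first-order
  row of `∂_{(U,V)}` is LINEAR in `(U,V)` and `M(prodVec (c·δ) 𝟙) = c·Mδ`, the persistent vector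
  `ε_μ ≠ 0` lies in `N_δ = {ε ∈ K : (Mᵢδ)·ε = 0 ∀ i}` and satisfies `-μ⁻¹·X ε_μ + Y ε_μ = 0` for the
  two row maps `X = (J_{∂_{(δ,0)} gᵢ} ·)ᵢ`, `Y = (J_{∂_{(0,𝟙)} gᵢ} ·)ᵢ` on `N_δ`
  (`exists_persists_id_orth`).
* (C) Hence `Y` is not injective on `N_δ`: otherwise, with a left inverse `G` of `Y`, every `μ ≠ 0`
  is an eigenvalue of `G ∘ X ∈ End(N_δ)` (eigenvector `ε_μ`), contradicting
  `Module.End.finite_hasEigenvalue`.  A nonzero `ε ∈ ker Y ∩ N_δ` is persistent along `(0,𝟙)`, i.e.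
  `ε ∈ E`, and `(Mᵢδ)·ε = 0 ∀ i`.
* (D) So the forms `bᵢ(x,y) = (Mᵢx)·y` on `E` satisfy the hypothesis of ISO; an isotropic
  `x ∈ E ∖ 0` has `quad_i(x) = 0 ∀ i` and `x ∈ K`, so `x = 0` by correctness
  (`Correct.eq_zero_of_isKer_of_quad`, M40) — contradiction.

## Main statements

* `IsotropicKernelLemma d`, `IsotropicKernelLemma.mono`, `isotropicKernelLemma_one`.
* `AffSystem.persistSpace` (+ `mem_persistSpace`, `persistSpace_le_kerSpace`),
  `AffTest.jac_hderiv_smul_left_id`, `exists_persists_id_orth` (steps B–C).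
* `AffSystem.Correct.exists_line_reduced_of_iso` (pointwise, with `finrank K(A,B) ≤ d` and ISO_d),
  `AffSystem.Correct.exists_line_reduced_of_finrank_le_one` (unconditional, pointwise form of M63),
  `depthBound_one_of_iso`, `horizontalUnmask_one_of_iso`,
  **`cubicEquationsForceMultiplication_of_iso : (∀ d, IsotropicKernelLemma d) → CEFM`**.
-/

set_option linter.dupNamespace false

namespace Summit.MatrixMultiplication.MatrixMultiplication.Theorems.GraphEquations

open Matrix

variable {n : ℕ}

/-! ## The isotropic kernel lemma -/

/-- **ISO_d — the isotropic kernel lemma in dimension `≤ d`.**  For bilinear forms `b₁, …, b_m` on a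
nonzero complex vector space `V` with `finrank V ≤ d`: if every `x ≠ 0` has a nonzero `y` with
`bᵢ x y = 0` for all `i`, then some `x ≠ 0` has `bᵢ x x = 0` for all `i`.  (True for every `d` by the
fixed-point principle for correspondences on `ℙV`; in the tree for `d ≤ 1` only, see
`isotropicKernelLemma_one`.) -/
def IsotropicKernelLemma (d : ℕ) : Prop :=
  ∀ (V : Type) [AddCommGroup V] [Module ℂ V] [FiniteDimensional ℂ V],
    Module.finrank ℂ V ≤ d →
    ∀ (m : ℕ) (b : Fin m → V →ₗ[ℂ] V →ₗ[ℂ] ℂ),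
      (∃ x : V, x ≠ 0) →
      (∀ x : V, x ≠ 0 → ∃ y : V, y ≠ 0 ∧ ∀ i, b i x y = 0) →
      ∃ x : V, x ≠ 0 ∧ ∀ i, b i x x = 0

/-- ISO is monotone in the dimension bound. -/
theorem IsotropicKernelLemma.mono {d d' : ℕ} (h : d ≤ d') (hI : IsotropicKernelLemma d') :
    IsotropicKernelLemma d :=
  fun V _ _ _ hd m b hne hyp => hI V (hd.trans h) m b hne hyp

/-- **ISO in dimension `≤ 1`** (trivial: `y` is a nonzero multiple of `x`). -/
theorem isotropicKernelLemma_one : IsotropicKernelLemma 1 := by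
  intro V _ _ _ hd m b hne hyp
  obtain ⟨x₀, hx₀⟩ := hne
  obtain ⟨y, hy0, hy⟩ := hyp x₀ hx₀
  have h1 : Module.finrank ℂ V = 1 :=
    le_antisymm hd (Module.finrank_pos_iff_exists_ne_zero.mpr ⟨x₀, hx₀⟩)
  obtain ⟨c, hc⟩ := (finrank_eq_one_iff_of_nonzero' y hy0).mp h1 x₀
  have hc0 : c ≠ 0 := fun hc0 => hx₀ (by rw [← hc, hc0, zero_smul])
  refine ⟨y, hy0, fun i => ?_⟩
  have := hy i
  rw [← hc, map_smul, LinearMap.smul_apply, smul_eq_mul, mul_eq_zero] at this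
  exact this.resolve_left hc0

/-! ## Row maps and the space of persistent vectors -/

/-- The row-evaluation map `ε ↦ (wᵢ · ε)ᵢ`. -/
def rowMap {m : ℕ} (w : Fin m → Vec n) : Vec n →ₗ[ℂ] (Fin m → ℂ) where
  toFun ε i := w i ⬝ᵥ ε
  map_add' a b := funext fun i => dotProduct_add (w i) a b
  map_smul' c a := funext fun i => by simp [dotProduct_smul]

/-- Components of the row map. -/
theorem rowMap_apply {m : ℕ} (w : Fin m → Vec n) (ε : Vec n) (i : Fin m) : rowMap w ε i = w i ⬝ᵥ ε :=
  rfl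

/-- The row map vanishes iff every row is orthogonal to the vector. -/
theorem rowMap_eq_zero_iff {m : ℕ} (w : Fin m → Vec n) (ε : Vec n) :
    rowMap w ε = 0 ↔ ∀ i, w i ⬝ᵥ ε = 0 :=
  ⟨fun h i => by simpa [rowMap_apply] using congrFun h i, fun h => funext h⟩

/-- **Linearity of the first-order row in the direction**, in the form used below:
`J_{∂_{(c·δ, 𝟙)} g} = c · J_{∂_{(δ,0)} g} + J_{∂_{(0,𝟙)} g}`. -/
theorem AffTest.jac_hderiv_smul_left_id (g : AffTest n) (c : ℂ) (δ A B : Vec n) :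
    (g.hderiv (c • δ) idFun).jac A B = c • (g.hderiv δ 0).jac A B + (g.hderiv 0 idFun).jac A B := by
  simp only [AffTest.jac_hderiv_eq_mulVec, mulVec_smul, mulVec_zero, add_zero, zero_add]

namespace AffSystem

/-- The space `P_{(U,V)}(A,B)` of kernel vectors persisting along the base line `(A,B) + ℂ(U,V)`. -/
def persistSpace (S : AffSystem n) (A B U V : Vec n) : Submodule ℂ (Vec n) where
  carrier := {δ | S.PersistsAlong A B U V δ}
  add_mem' {a b} ha hb := fun t i => by
    rw [dotProduct_add, (show S.PersistsAlong A B U V a from ha) t i,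
      (show S.PersistsAlong A B U V b from hb) t i, add_zero]
  zero_mem' := fun t i => dotProduct_zero _
  smul_mem' c a ha := fun t i => by
    rw [dotProduct_smul, (show S.PersistsAlong A B U V a from ha) t i, smul_zero]

variable {S : AffSystem n}

/-- Membership in the persistence space. -/
theorem mem_persistSpace {A B U V δ : Vec n} :
    δ ∈ S.persistSpace A B U V ↔ S.PersistsAlong A B U V δ :=
  Iff.rfl

/-- Persistent vectors are kernel vectors at the base point. -/
theorem persistSpace_le_kerSpace (A B U V : Vec n) : S.persistSpace A B U V ≤ S.kerSpace A B :=
  fun δ h => mem_kerSpace.mpr (by simpa using (show S.PersistsAlong A B U V δ from h) 0)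

end AffSystem

/-! ## Steps B–C: a persistent vector along `(0,𝟙)` orthogonal to `Mᵢδ` -/

/-- **Steps B–C.**  If every base line through `(A,B)` carries a nonzero persistent vector, then for
every `δ` there is a nonzero vector persisting along `(0, 𝟙)` and orthogonal to all `Mᵢ δ`
(directions `(-μ⁻¹·δ, 𝟙)`, `μ ≠ 0`, and finiteness of the spectrum of `G ∘ X`). -/
theorem exists_persists_id_orth {S : AffSystem n} {A B : Vec n}
    (H : ∀ U V : Vec n, ∃ ε, S.PersistsAlong A B U V ε ∧ ε ≠ 0) (δ : Vec n) :
    ∃ ε, S.PersistsAlong A B 0 idFun ε ∧ ε ≠ 0 ∧ ∀ i, ((S.test i).M *ᵥ δ) ⬝ᵥ ε = 0 := by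
  classical
  set N : Submodule ℂ (Vec n) :=
    S.kerSpace A B ⊓ LinearMap.ker (rowMap fun i => (S.test i).M *ᵥ δ) with hN
  have memN : ∀ {ε : Vec n}, ε ∈ N ↔ S.IsKer A B ε ∧ ∀ i, ((S.test i).M *ᵥ δ) ⬝ᵥ ε = 0 :=
    fun {ε} => by
    rw [hN, Submodule.mem_inf, AffSystem.mem_kerSpace, LinearMap.mem_ker, rowMap_eq_zero_iff]
  set xN : N →ₗ[ℂ] (Fin S.m → ℂ) :=
    (rowMap fun i => ((S.test i).hderiv δ 0).jac A B).comp N.subtype with hxN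
  set yN : N →ₗ[ℂ] (Fin S.m → ℂ) :=
    (rowMap fun i => ((S.test i).hderiv 0 idFun).jac A B).comp N.subtype with hyN
  -- (B) for every `μ ≠ 0` a nonzero `e ∈ N` with `-μ⁻¹ • xN e + yN e = 0`
  have key : ∀ μ : ℂ, μ ≠ 0 → ∃ e : N, e ≠ 0 ∧ (-μ⁻¹ : ℂ) • xN e + yN e = 0 := by
    intro μ hμ
    obtain ⟨ε, hε, hε0⟩ := H ((-μ⁻¹ : ℂ) • δ) idFun
    obtain ⟨hK, h1, h2⟩ := AffSystem.persistsAlong_iff.mp hε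
    have hmem : ε ∈ N := by
      refine memN.mpr ⟨hK, fun i => ?_⟩
      have := h2 i
      rw [prodVec_smul_left, prodVec_idFun, mulVec_smul, smul_dotProduct, smul_eq_mul,
        mul_eq_zero] at this
      exact this.resolve_left (neg_ne_zero.mpr (inv_ne_zero hμ))
    refine ⟨⟨ε, hmem⟩, fun h => hε0 (congrArg Subtype.val h), funext fun i => ?_⟩
    have := h1 i
    rw [AffTest.jac_hderiv_smul_left_id, add_dotProduct, smul_dotProduct, smul_eq_mul] at this
    simpa [hxN, hyN, rowMap_apply] using this
  -- (C) `yN` is not injective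
  suffices hy : LinearMap.ker yN ≠ ⊥ by
    obtain ⟨e, he, he0⟩ := (Submodule.ne_bot_iff _).mp hy
    refine ⟨(e : Vec n), ?_, fun h => he0 (Subtype.ext h), (memN.mp e.2).2⟩
    refine AffSystem.persistsAlong_iff.mpr ⟨(memN.mp e.2).1, fun i => ?_, fun i => ?_⟩
    · have := congrFun (LinearMap.mem_ker.mp he) i
      simpa [hyN, rowMap_apply] using this
    · rw [prodVec_idFun, mulVec_zero, zero_dotProduct]
  intro hy
  obtain ⟨G, hG⟩ := LinearMap.exists_leftInverse_of_injective yN hy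
  set f : Module.End ℂ N := G.comp xN with hf
  have hev : ∀ μ : ℂ, μ ≠ 0 → f.HasEigenvalue μ := by
    intro μ hμ
    obtain ⟨e, he0, hrel⟩ := key μ hμ
    have hGe : G (yN e) = e := by
      have := LinearMap.congr_fun hG e
      simpa using this
    have h3 : (-μ⁻¹ : ℂ) • f e + e = 0 := by
      have := congrArg G hrel
      rw [map_add, map_smul, map_zero, hGe] at this
      simpa [hf] using this
    have h4 : (-μ⁻¹ : ℂ) • f e = -e := eq_neg_of_add_eq_zero_left h3
    have h5 : f e = μ • e := by
      calc f e = ((-μ) * (-μ⁻¹)) • f e := by rw [neg_mul_neg, mul_inv_cancel₀ hμ, one_smul]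
        _ = (-μ) • ((-μ⁻¹ : ℂ) • f e) := by rw [smul_smul]
        _ = μ • e := by rw [h4, smul_neg, neg_smul, neg_neg]
    exact Module.End.hasEigenvalue_of_hasEigenvector
      (Module.End.hasEigenvector_iff.mpr ⟨Module.End.mem_eigenspace_iff.mpr h5, he0⟩)
  have hfin : Set.Finite {μ : ℂ | f.HasEigenvalue μ} := f.finite_hasEigenvalue
  have hsub : ({0}ᶜ : Set ℂ) ⊆ {μ : ℂ | f.HasEigenvalue μ} :=
    fun μ hμ => hev μ (by simpa using hμ)
  haveI : Infinite ℂ := Infinite.of_injective _ Nat.cast_injective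
  exact (Set.finite_singleton (0 : ℂ)).infinite_compl (hfin.subset hsub)

/-! ## Step D: pointwise purification modulo ISO, and the consequences -/

namespace AffSystem

variable {S : AffSystem n}

/-- The bilinear forms `bᵢ(x,y) = (Mᵢ x) · y` restricted to a subspace. -/
def orthForm (S : AffSystem n) (E : Submodule ℂ (Vec n)) (i : Fin S.m) : E →ₗ[ℂ] E →ₗ[ℂ] ℂ :=
  LinearMap.mk₂ ℂ (fun x y => ((S.test i).M *ᵥ (x : Vec n)) ⬝ᵥ (y : Vec n))
    (fun x x' y => by simp only [Submodule.coe_add, mulVec_add, add_dotProduct])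
    (fun c x y => by simp only [Submodule.coe_smul, mulVec_smul, smul_dotProduct])
    (fun x y y' => by simp only [Submodule.coe_add, dotProduct_add])
    (fun c x y => by simp only [Submodule.coe_smul, dotProduct_smul])

/-- Values of the restricted forms. -/
theorem orthForm_apply (E : Submodule ℂ (Vec n)) (i : Fin S.m) (x y : E) :
    S.orthForm E i x y = ((S.test i).M *ᵥ (x : Vec n)) ⬝ᵥ (y : Vec n) :=
  rfl

/-- **POINTWISE PURIFICATION modulo ISO.**  If `S` is correct, `finrank K(A,B) ≤ d` and ISO_d holds,
then two horizontal rounds along SOME direction purify `S` at `(A,B)`. -/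
theorem Correct.exists_line_reduced_of_iso {d : ℕ} (hISO : IsotropicKernelLemma d) (hC : S.Correct)
    {A B : Vec n} (hd : Module.finrank ℂ (S.kerSpace A B) ≤ d) :
    ∃ U V : Vec n, (S.happend₂ U V).ReducedAt A B := by
  by_contra H
  push Not at H
  have H' : ∀ U V : Vec n, ∃ ε, S.PersistsAlong A B U V ε ∧ ε ≠ 0 := fun U V => by
    have := H U V
    rw [reducedAt_happend₂_iff] at this
    push Not at this
    exact this
  set E := S.persistSpace A B 0 idFun with hE
  have hEd : Module.finrank ℂ E ≤ d :=
    (Submodule.finrank_mono (persistSpace_le_kerSpace A B 0 idFun)).trans hd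
  obtain ⟨ε₀, hε₀, hε₀0⟩ := H' 0 idFun
  have hne : ∃ x : E, x ≠ 0 := ⟨⟨ε₀, hε₀⟩, fun h => hε₀0 (congrArg Subtype.val h)⟩
  have hyp : ∀ x : E, x ≠ 0 → ∃ y : E, y ≠ 0 ∧ ∀ i, S.orthForm E i x y = 0 := fun x _ => by
    obtain ⟨ε, hε, hε0, horth⟩ := exists_persists_id_orth H' (x : Vec n)
    exact ⟨⟨ε, hε⟩, fun h => hε0 (congrArg Subtype.val h), fun i => horth i⟩
  obtain ⟨x, hx0, hx⟩ := hISO E hEd S.m (S.orthForm E) hne hyp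
  have hK : S.IsKer A B x := by
    simpa using (show S.PersistsAlong A B 0 idFun x from x.2) 0
  have h0 : (x : Vec n) = 0 := hC.eq_zero_of_isKer_of_quad hK fun i => hx i
  exact hx0 (Subtype.ext h0)

/-- **Unconditional pointwise form of M63**: a base of corank `≤ 1` is purified by two rounds along
some direction. -/
theorem Correct.exists_line_reduced_of_finrank_le_one (hC : S.Correct) {A B : Vec n}
    (hd : Module.finrank ℂ (S.kerSpace A B) ≤ 1) : ∃ U V : Vec n, (S.happend₂ U V).ReducedAt A B :=
  hC.exists_line_reduced_of_iso isotropicKernelLemma_one hd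

/-- With ISO in dimension `n²`, EVERY base of every correct system is purified by some direction. -/
theorem Correct.exists_line_reduced_of_iso_sq (hISO : IsotropicKernelLemma (n * n)) (hC : S.Correct)
    (A B : Vec n) : ∃ U V : Vec n, (S.happend₂ U V).ReducedAt A B := by
  refine hC.exists_line_reduced_of_iso hISO ((Submodule.finrank_le _).trans ?_)
  rw [Module.finrank_fintype_fun_eq_card, Fintype.card_prod, Fintype.card_fin]

end AffSystem

/-- **`DepthBound n 1` modulo ISO_{n²}.** -/
theorem depthBound_one_of_iso (hISO : IsotropicKernelLemma (n * n)) : DepthBound n 1 :=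
  depthBound_one_iff.mpr fun S hS => by
    obtain ⟨U, V, h⟩ := hS.exists_line_reduced_of_iso_sq hISO 0 0
    exact ⟨0, 0, U, V, h⟩

/-- **`HorizontalUnmask 1 n` modulo ISO_{n²}.** -/
theorem horizontalUnmask_one_of_iso (hISO : IsotropicKernelLemma (n * n)) : HorizontalUnmask 1 n :=
  horizontalUnmask_iff_depthBound.mpr (depthBound_one_of_iso hISO)

/-- **`[ω₃ = ω]` modulo the isotropic kernel lemma**: if ISO holds in every dimension then cubic
verification systems force multiplication (`CubicEquationsForceMultiplication`), with the
constant-overhead bound `R(⟨n,n,n⟩) ≤ 18 · cost` of M60a along the purifying direction. -/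
theorem cubicEquationsForceMultiplication_of_iso (hISO : ∀ d, IsotropicKernelLemma d) :
    CubicEquationsForceMultiplication :=
  cubicEquationsForceMultiplication_of_depthBound 1 fun n _ => depthBound_one_of_iso (hISO (n * n))

end Summit.MatrixMultiplication.MatrixMultiplication.Theorems.GraphEquations
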